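import Literature.Topology.FourManifolds.CompactSupportFlow
import Literature.Topology.FourManifolds.WhitneyModelSheets
import HarnessLib

/-!
# The thickening of a Whitney disc by two flows (metric-free substitute for Milnor 1965,
# Completion of Proof of Lemma 6.7, PDF p. 45: `(u, x, y) ↦ exp[x ξ(φ₃ u) + y η(φ₃ u)]`)

Topic `Literature/Topology/FourManifolds`; infrastructure for the discharge of the named fact
`Literature.Topology.FourManifolds.FreedmanQuinn1990_whitneyMove` (`FramedWhitneyDisc.lean`:
the Whitney move in dimension four, Freedman–Quinn 1990 §1.4, from Milnor's Lemma 6.7 for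
`r = s = 2`).  Milnor thickens the Whitney disc `φ₃ : U → V` to the standard model
`U × R × R → V` with the exponential map of a Riemannian metric for which the two sheets `M`, `M'`
are totally geodesic near the Whitney arcs (Lemmas 6.8, 6.13), so that the `x`-lines through the
arc `C ⊂ M` stay in `M` and the `y`-lines through `C' ⊂ M'` stay in `M'`.  Mathlib has no
exponential map; the tree has flows of compactly supported vector fields on non-compact manifolds
(`CompactSupportFlow.lean`).  This file provides the substitute used by the discharge:

* the thickening `Θ (u, (a, b)) = Ψ_b (Φ_a (W u))` of a map `W : ℝ × ℝ → X` by two ambient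
  isotopies (in the application: the flows of two vector fields `ξ`, `η` on `X`; the theorems take
  any `Θ` with this defining equation, no definition is introduced); `flowTube_zero`: it restricts
  to `W` on the zero section; `contMDiffOn_flowTube`: it is `C^∞` over the set where `W` is;
* the differential along the zero section (`mfderiv_flowTube_inl`, `mfderiv_flowTube_xi`,
  `mfderiv_flowTube_eta`): `dΘ_{(u,0)} (v, (a, b)) = dW_u v + a ξ(W u) + b η(W u)` when the tracks
  of `Φ`, `Ψ` are integral curves of `ξ`, `η`; hence (`injective_mfderiv_flowTube`,
  `isLocalDiffeomorphAt_flowTube`) `Θ` is a local diffeomorphism at `(u, 0)` as soon as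
  `dW_u e₁, dW_u e₂, ξ(W u), η(W u)` is a frame — Milnor's *"this map is a local diffeomorphism"*;
* `Literature.Topology.FourManifolds.flow_apply_eq_of_tangent` — **total geodesy
  replaced by flow invariance**: if a smooth vector field `Y` on a manifold `B` is `p`-related to
  `ξ` on an open set `N` (`dp (Y b) = ξ (p b)`, `b ∈ N`) for a smooth map `p : B → X`, then for `b`
  near a point of `N` and small times the `ξ`-track of `p b` is `p` of the `Y`-track of `b`, in
  particular it stays in `p(N)` (uniqueness of integral curves, Mathlib's
  `isMIntegralCurveOn_Ioo_eqOn_of_contMDiff_boundaryless`, and the tree's smooth local flows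
  `exists_contMDiffOn_localFlow`).

Everything here is proved; no definitions, no named facts.

## References

* J. Milnor, *Lectures on the h-cobordism theorem*, notes by L. Siebenmann and J. Sondow,
  Princeton Mathematical Notes (1965), Completion of Proof of Lemma 6.7 (PDF p. 45), Lemma 6.8
  (PDF p. 41).  Held: `lit read book:milnornd-lectures-h-cobordism-theorem --pages 41-45`.
  [MilnorHCobordism1965]
* J. M. Lee, *Introduction to Smooth Manifolds*, 2nd ed., GTM 218 (2013), Prop. 9.6, Cor. 9.14
  (naturality of integral curves under related vector fields). [LeeSmoothManifolds2013]
-/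

open scoped Manifold ContDiff Topology
open Set Function Filter

noncomputable section

namespace Literature.Topology.FourManifolds

section Tube

variable {E : Type*} [NormedAddCommGroup E] [NormedSpace ℝ E] {H : Type*} [TopologicalSpace H]
  {I : ModelWithCorners ℝ E H} {X : Type*} [TopologicalSpace X] [ChartedSpace H X]

/-! The **two-flow thickening** of a map `W : ℝ × ℝ → X` by two ambient isotopies `Φ`, `Ψ`
of `X` is the map `Θ (u, (a, b)) = Ψ_b (Φ_a (W u))` (in the application `Φ`, `Ψ` are the flows
of vector fields `ξ`, `η` framing the normal bundle of a Whitney disc `W`, and this is the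
metric-free replacement of Milnor's `(u, x, y) ↦ exp[x ξ(φ₃ u) + y η(φ₃ u)]`, PDF p. 45).  No
definition is introduced: the theorems below are about any `Θ` satisfying the defining equation
`hΘ`. -/

variable (Φ Ψ : AmbientIsotopy I X) (W : ℝ × ℝ → X) {Θ : (ℝ × ℝ) × (ℝ × ℝ) → X}
  (hΘ : ∀ z, Θ z = Ψ.toFun z.2.2 (Φ.toFun z.2.1 (W z.1)))
include hΘ

/-- On the zero section the thickening is `W`. [folklore] -/
theorem flowTube_zero (u : ℝ × ℝ) : Θ (u, 0) = W u := by
  simp [hΘ, Φ.map_zero, Ψ.map_zero]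

/-- On the zero section the thickening is `W` (pair form). [folklore] -/
theorem flowTube_zero' (u : ℝ × ℝ) : Θ (u, ((0 : ℝ), (0 : ℝ))) = W u :=
  flowTube_zero Φ Ψ W hΘ u

/-- Along the first fibre coordinate the thickening follows the tracks of `Φ`. [folklore] -/
theorem flowTube_inl (u : ℝ × ℝ) (a : ℝ) : Θ (u, (a, 0)) = Φ.toFun a (W u) := by
  simp [hΘ, Ψ.map_zero]

/-- Along the second fibre coordinate the thickening follows the tracks of `Ψ`. [folklore] -/
theorem flowTube_inr (u : ℝ × ℝ) (b : ℝ) : Θ (u, (0, b)) = Ψ.toFun b (W u) := by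
  simp [hΘ, Φ.map_zero]

omit hΘ in
/-- The defining equation as an equation of functions. [folklore] -/
theorem flowTube_eq (hΘ : ∀ z, Θ z = Ψ.toFun z.2.2 (Φ.toFun z.2.1 (W z.1))) :
    Θ = fun z => Ψ.toFun z.2.2 (Φ.toFun z.2.1 (W z.1)) := funext hΘ

/-- **The thickening is smooth over the set where `W` is.** [folklore] -/
theorem contMDiffOn_flowTube {U : Set (ℝ × ℝ)} (hW : ContMDiffOn 𝓘(ℝ, ℝ × ℝ) I ∞ W U) :
    ContMDiffOn 𝓘(ℝ, (ℝ × ℝ) × (ℝ × ℝ)) I ∞ Θ (U ×ˢ univ) := by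
  have h1 : ContMDiffOn 𝓘(ℝ, (ℝ × ℝ) × (ℝ × ℝ)) 𝓘(ℝ, ℝ) ∞
      (fun z : (ℝ × ℝ) × (ℝ × ℝ) => z.2.1) (U ×ˢ univ) := by
    rw [contMDiffOn_iff_contDiffOn]
    exact (contDiff_fst.comp contDiff_snd).contDiffOn
  have h2 : ContMDiffOn 𝓘(ℝ, (ℝ × ℝ) × (ℝ × ℝ)) 𝓘(ℝ, ℝ) ∞
      (fun z : (ℝ × ℝ) × (ℝ × ℝ) => z.2.2) (U ×ˢ univ) := by
    rw [contMDiffOn_iff_contDiffOn]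
    exact (contDiff_snd.comp contDiff_snd).contDiffOn
  have h3 : ContMDiffOn 𝓘(ℝ, (ℝ × ℝ) × (ℝ × ℝ)) 𝓘(ℝ, ℝ × ℝ) ∞
      (fun z : (ℝ × ℝ) × (ℝ × ℝ) => z.1) (U ×ˢ univ) := by
    rw [contMDiffOn_iff_contDiffOn]
    exact contDiff_fst.contDiffOn
  have hW' : ContMDiffOn 𝓘(ℝ, (ℝ × ℝ) × (ℝ × ℝ)) I ∞ (fun z : (ℝ × ℝ) × (ℝ × ℝ) => W z.1)
      (U ×ˢ univ) := hW.comp h3 fun z hz => hz.1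
  have h4 : ContMDiffOn 𝓘(ℝ, (ℝ × ℝ) × (ℝ × ℝ)) I ∞
      (fun z : (ℝ × ℝ) × (ℝ × ℝ) => Φ.toFun z.2.1 (W z.1)) (U ×ˢ univ) :=
    Φ.contMDiff.comp_contMDiffOn (h1.prodMk hW')
  rw [flowTube_eq Φ Ψ W hΘ]
  exact Ψ.contMDiff.comp_contMDiffOn (h2.prodMk h4)

/-- The thickening is smooth at the points over the (open) set where `W` is. [folklore] -/
theorem contMDiffAt_flowTube {U : Set (ℝ × ℝ)} (hU : IsOpen U)
    (hW : ContMDiffOn 𝓘(ℝ, ℝ × ℝ) I ∞ W U) {z : (ℝ × ℝ) × (ℝ × ℝ)} (hz : z.1 ∈ U) :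
    ContMDiffAt 𝓘(ℝ, (ℝ × ℝ) × (ℝ × ℝ)) I ∞ Θ z :=
  (contMDiffOn_flowTube Φ Ψ W hΘ hW).contMDiffAt
    ((hU.prod isOpen_univ).mem_nhds ⟨hz, mem_univ _⟩)

/-! ### The differential along the zero section -/

section Deriv

/-- **Base directions**: `dΘ_{(u,0)} (v, 0) = dW_u v` (the zero section of the thickening is
`W`). [folklore] -/
theorem mfderiv_flowTube_inl {U : Set (ℝ × ℝ)} (hU : IsOpen U)
    (hW : ContMDiffOn 𝓘(ℝ, ℝ × ℝ) I ∞ W U) {u : ℝ × ℝ} (hu : u ∈ U) (v : ℝ × ℝ) :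
    mfderiv 𝓘(ℝ, (ℝ × ℝ) × (ℝ × ℝ)) I Θ (u, 0) (v, 0) =
      mfderiv 𝓘(ℝ, ℝ × ℝ) I W u v := by
  set j : ℝ × ℝ → (ℝ × ℝ) × (ℝ × ℝ) := fun u' => (u', 0) with hj
  have hcomp : Θ ∘ j = W := funext fun u' => flowTube_zero Φ Ψ W hΘ u'
  have hjL : ∀ u', mfderiv 𝓘(ℝ, ℝ × ℝ) 𝓘(ℝ, (ℝ × ℝ) × (ℝ × ℝ)) j u' =
      ContinuousLinearMap.inl ℝ (ℝ × ℝ) (ℝ × ℝ) := fun u' => by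
    rw [hj, mfderiv_eq_fderiv]
    exact (ContinuousLinearMap.inl ℝ (ℝ × ℝ) (ℝ × ℝ)).fderiv
  have hjd : MDifferentiableAt 𝓘(ℝ, ℝ × ℝ) 𝓘(ℝ, (ℝ × ℝ) × (ℝ × ℝ)) j u := by
    rw [hj, mdifferentiableAt_iff_differentiableAt]
    exact (ContinuousLinearMap.inl ℝ (ℝ × ℝ) (ℝ × ℝ)).differentiableAt
  have hΘd : MDifferentiableAt 𝓘(ℝ, (ℝ × ℝ) × (ℝ × ℝ)) I Θ (j u) :=
    (contMDiffAt_flowTube Φ Ψ W hΘ hU hW (z := (u, 0)) hu).mdifferentiableAt (by simp)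
  have key := mfderiv_comp u hΘd hjd
  rw [hcomp] at key
  rw [hjL] at key
  -- `j u = (u, 0)` and `inl v = (v, 0)`, definitionally
  exact (congrArg (fun L : TangentSpace 𝓘(ℝ, ℝ × ℝ) u →L[ℝ] TangentSpace I (W u) => L v)
    key).symm

variable {ξ η : Π x : X, TangentSpace I x}

set_option backward.isDefEq.respectTransparency false in
/-- **First fibre direction**: if the tracks of `Φ` are integral curves of `ξ` then
`dΘ_{(u,0)} (0, (1, 0)) = ξ (W u)`. [folklore] -/
theorem mfderiv_flowTube_xi (hΦ : ∀ x, IsMIntegralCurve (fun t => Φ.toFun t x) ξ)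
    {U : Set (ℝ × ℝ)} (hU : IsOpen U) (hW : ContMDiffOn 𝓘(ℝ, ℝ × ℝ) I ∞ W U) {u : ℝ × ℝ}
    (hu : u ∈ U) :
    mfderiv 𝓘(ℝ, (ℝ × ℝ) × (ℝ × ℝ)) I Θ (u, 0) (0, (1, 0)) = ξ (W u) := by
  -- the curve `a ↦ (u, (a, 0))` and its derivative
  set L : ℝ →L[ℝ] (ℝ × ℝ) × (ℝ × ℝ) :=
    (ContinuousLinearMap.inr ℝ (ℝ × ℝ) (ℝ × ℝ)).comp (ContinuousLinearMap.inl ℝ ℝ ℝ) with hL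
  have hLa : ∀ a : ℝ, L a = (0, (a, 0)) := fun a => rfl
  set k : ℝ → (ℝ × ℝ) × (ℝ × ℝ) := fun a => (u, (a, 0)) with hk
  have hk' : k = fun a => ((u, 0) : (ℝ × ℝ) × (ℝ × ℝ)) + L a := by
    funext a
    rw [hLa, hk]
    ext <;> simp
  have hkL : mfderiv 𝓘(ℝ, ℝ) 𝓘(ℝ, (ℝ × ℝ) × (ℝ × ℝ)) k 0 = L := by
    rw [mfderiv_eq_fderiv, hk']
    exact ((L.hasFDerivAt).const_add _).fderiv
  have hkd : MDifferentiableAt 𝓘(ℝ, ℝ) 𝓘(ℝ, (ℝ × ℝ) × (ℝ × ℝ)) k 0 := by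
    rw [mdifferentiableAt_iff_differentiableAt, hk']
    exact ((L.hasFDerivAt).const_add _).differentiableAt
  have hk0 : k 0 = (u, 0) := rfl
  -- the composite is the `ξ`-track of `W u`
  have hcomp : Θ ∘ k = fun a => Φ.toFun a (W u) :=
    funext fun a => flowTube_inl Φ Ψ W hΘ u a
  have hΘd : MDifferentiableAt 𝓘(ℝ, (ℝ × ℝ) × (ℝ × ℝ)) I Θ (k 0) :=
    (contMDiffAt_flowTube Φ Ψ W hΘ hU hW (z := (u, 0)) hu).mdifferentiableAt (by simp)
  have key := mfderiv_comp (0 : ℝ) hΘd hkd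
  rw [hcomp, (hΦ (W u) 0).mfderiv, hkL] at key
  have h0 : Φ.toFun 0 (W u) = W u := by rw [Φ.map_zero]; rfl
  have := congrArg (fun M : ℝ →L[ℝ] TangentSpace I (Φ.toFun 0 (W u)) => M (1 : ℝ)) key
  simp only [ContinuousLinearMap.smulRight_apply] at this
  have h11 : ((1 : ℝ →L[ℝ] ℝ) : ℝ → ℝ) 1 = 1 := rfl
  rw [h11, one_smul, h0] at this
  -- `k 0 = (u, 0)` and `L 1 = (0, (1, 0))`, definitionally
  exact this.symm

set_option backward.isDefEq.respectTransparency false in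
/-- **Second fibre direction**: if the tracks of `Ψ` are integral curves of `η` then
`dΘ_{(u,0)} (0, (0, 1)) = η (W u)`. [folklore] -/
theorem mfderiv_flowTube_eta (hΨ : ∀ x, IsMIntegralCurve (fun t => Ψ.toFun t x) η)
    {U : Set (ℝ × ℝ)} (hU : IsOpen U) (hW : ContMDiffOn 𝓘(ℝ, ℝ × ℝ) I ∞ W U) {u : ℝ × ℝ}
    (hu : u ∈ U) :
    mfderiv 𝓘(ℝ, (ℝ × ℝ) × (ℝ × ℝ)) I Θ (u, 0) (0, (0, 1)) = η (W u) := by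
  set L : ℝ →L[ℝ] (ℝ × ℝ) × (ℝ × ℝ) :=
    (ContinuousLinearMap.inr ℝ (ℝ × ℝ) (ℝ × ℝ)).comp (ContinuousLinearMap.inr ℝ ℝ ℝ) with hL
  have hLa : ∀ b : ℝ, L b = (0, (0, b)) := fun b => rfl
  set k : ℝ → (ℝ × ℝ) × (ℝ × ℝ) := fun b => (u, (0, b)) with hk
  have hk' : k = fun b => ((u, 0) : (ℝ × ℝ) × (ℝ × ℝ)) + L b := by
    funext b
    rw [hLa, hk]
    ext <;> simp
  have hkL : mfderiv 𝓘(ℝ, ℝ) 𝓘(ℝ, (ℝ × ℝ) × (ℝ × ℝ)) k 0 = L := by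
    rw [mfderiv_eq_fderiv, hk']
    exact ((L.hasFDerivAt).const_add _).fderiv
  have hkd : MDifferentiableAt 𝓘(ℝ, ℝ) 𝓘(ℝ, (ℝ × ℝ) × (ℝ × ℝ)) k 0 := by
    rw [mdifferentiableAt_iff_differentiableAt, hk']
    exact ((L.hasFDerivAt).const_add _).differentiableAt
  have hcomp : Θ ∘ k = fun b => Ψ.toFun b (W u) :=
    funext fun b => flowTube_inr Φ Ψ W hΘ u b
  have hΘd : MDifferentiableAt 𝓘(ℝ, (ℝ × ℝ) × (ℝ × ℝ)) I Θ (k 0) :=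
    (contMDiffAt_flowTube Φ Ψ W hΘ hU hW (z := (u, 0)) hu).mdifferentiableAt (by simp)
  have key := mfderiv_comp (0 : ℝ) hΘd hkd
  rw [hcomp, (hΨ (W u) 0).mfderiv, hkL] at key
  have h0 : Ψ.toFun 0 (W u) = W u := by rw [Ψ.map_zero]; rfl
  have := congrArg (fun M : ℝ →L[ℝ] TangentSpace I (Ψ.toFun 0 (W u)) => M (1 : ℝ)) key
  simp only [ContinuousLinearMap.smulRight_apply] at this
  have h11 : ((1 : ℝ →L[ℝ] ℝ) : ℝ → ℝ) 1 = 1 := rfl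
  rw [h11, one_smul, h0] at this
  exact this.symm

set_option backward.isDefEq.respectTransparency false in
/-- **The differential of the thickening along the zero section**:
`dΘ_{(u,0)} (v, (a, b)) = v₁ dW_u e₁ + v₂ dW_u e₂ + a ξ(W u) + b η(W u)`. [folklore] -/
theorem mfderiv_flowTube_apply (hΦ : ∀ x, IsMIntegralCurve (fun t => Φ.toFun t x) ξ)
    (hΨ : ∀ x, IsMIntegralCurve (fun t => Ψ.toFun t x) η)
    {U : Set (ℝ × ℝ)} (hU : IsOpen U) (hW : ContMDiffOn 𝓘(ℝ, ℝ × ℝ) I ∞ W U) {u : ℝ × ℝ}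
    (hu : u ∈ U) (v : ℝ × ℝ) (a b : ℝ) :
    mfderiv 𝓘(ℝ, (ℝ × ℝ) × (ℝ × ℝ)) I Θ (u, 0) (v, (a, b)) =
      v.1 • mfderiv 𝓘(ℝ, ℝ × ℝ) I W u (1, 0) + v.2 • mfderiv 𝓘(ℝ, ℝ × ℝ) I W u (0, 1) +
        a • ξ (W u) + b • η (W u) := by
  set D := mfderiv 𝓘(ℝ, (ℝ × ℝ) × (ℝ × ℝ)) I Θ (u, 0) with hD
  have hsplit : ((v, (a, b)) : (ℝ × ℝ) × (ℝ × ℝ)) =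
      v.1 • (((1 : ℝ), (0 : ℝ)), ((0 : ℝ), (0 : ℝ))) + v.2 • (((0 : ℝ), (1 : ℝ)), ((0 : ℝ), (0 : ℝ))) +
        a • (((0 : ℝ), (0 : ℝ)), ((1 : ℝ), (0 : ℝ))) + b • (((0 : ℝ), (0 : ℝ)), ((0 : ℝ), (1 : ℝ))) := by
    ext <;> simp
  have h1 : D (((1 : ℝ), (0 : ℝ)), ((0 : ℝ), (0 : ℝ))) = mfderiv 𝓘(ℝ, ℝ × ℝ) I W u (1, 0) :=
    mfderiv_flowTube_inl Φ Ψ W hΘ hU hW hu (1, 0)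
  have h2 : D (((0 : ℝ), (1 : ℝ)), ((0 : ℝ), (0 : ℝ))) = mfderiv 𝓘(ℝ, ℝ × ℝ) I W u (0, 1) :=
    mfderiv_flowTube_inl Φ Ψ W hΘ hU hW hu (0, 1)
  have h3 : D (((0 : ℝ), (0 : ℝ)), ((1 : ℝ), (0 : ℝ))) = ξ (W u) :=
    mfderiv_flowTube_xi Φ Ψ W hΘ hΦ hU hW hu
  have h4 : D (((0 : ℝ), (0 : ℝ)), ((0 : ℝ), (1 : ℝ))) = η (W u) :=
    mfderiv_flowTube_eta Φ Ψ W hΘ hΨ hU hW hu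
  rw [hsplit, map_add, map_add, map_add, map_smul, map_smul, map_smul, map_smul, h1, h2, h3, h4]

set_option backward.isDefEq.respectTransparency false in
/-- **The thickening has injective differential along the zero section when
`dW e₁, dW e₂, ξ ∘ W, η ∘ W` is a frame** (Milnor: *"this map is a local diffeomorphism"*).
[cite: MilnorHCobordism1965, Completion of Proof of Lemma 6.7 (PDF p. 45)] -/
theorem injective_mfderiv_flowTube (hΦ : ∀ x, IsMIntegralCurve (fun t => Φ.toFun t x) ξ)
    (hΨ : ∀ x, IsMIntegralCurve (fun t => Ψ.toFun t x) η)
    {U : Set (ℝ × ℝ)} (hU : IsOpen U) (hW : ContMDiffOn 𝓘(ℝ, ℝ × ℝ) I ∞ W U) {u : ℝ × ℝ}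
    (hu : u ∈ U)
    (hfr : LinearIndependent ℝ
      ![mfderiv 𝓘(ℝ, ℝ × ℝ) I W u (1, 0), mfderiv 𝓘(ℝ, ℝ × ℝ) I W u (0, 1), ξ (W u), η (W u)]) :
    Injective (mfderiv 𝓘(ℝ, (ℝ × ℝ) × (ℝ × ℝ)) I Θ (u, 0)) := by
  set D := mfderiv 𝓘(ℝ, (ℝ × ℝ) × (ℝ × ℝ)) I Θ (u, 0) with hD
  rw [injective_iff_map_eq_zero]
  rintro ⟨v, a, b⟩ hz
  rw [hD, mfderiv_flowTube_apply Φ Ψ W hΘ hΦ hΨ hU hW hu v a b] at hz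
  -- the coefficient family
  set g : Fin 4 → ℝ := ![v.1, v.2, a, b] with hg
  have hsum : ∑ i, g i • ![mfderiv 𝓘(ℝ, ℝ × ℝ) I W u (1, 0), mfderiv 𝓘(ℝ, ℝ × ℝ) I W u (0, 1),
      ξ (W u), η (W u)] i = 0 := by
    rw [Fin.sum_univ_four]
    simpa [hg] using hz
  have hzero := Fintype.linearIndependent_iff.1 hfr g hsum
  have h0 : v.1 = 0 := hzero 0
  have h1 : v.2 = 0 := hzero 1
  have h2 : a = 0 := hzero 2
  have h3 : b = 0 := hzero 3
  show ((v, (a, b)) : (ℝ × ℝ) × (ℝ × ℝ)) = 0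
  rw [h2, h3, show v = 0 from Prod.ext h0 h1]
  rfl

/-- **The thickening is a local diffeomorphism at the points of the zero section where
`dW e₁, dW e₂, ξ ∘ W, η ∘ W` is a frame**, for a four-dimensional target (inverse function
theorem, `isLocalDiffeomorphAt_of_mfderiv_injective`).
[cite: MilnorHCobordism1965, Completion of Proof of Lemma 6.7 (PDF p. 45)] -/
theorem isLocalDiffeomorphAt_flowTube [IsManifold I ∞ X] [I.Boundaryless] [FiniteDimensional ℝ E]
    (hE : Module.finrank ℝ E = 4)
    (hΦ : ∀ x, IsMIntegralCurve (fun t => Φ.toFun t x) ξ)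
    (hΨ : ∀ x, IsMIntegralCurve (fun t => Ψ.toFun t x) η)
    {U : Set (ℝ × ℝ)} (hU : IsOpen U) (hW : ContMDiffOn 𝓘(ℝ, ℝ × ℝ) I ∞ W U) {u : ℝ × ℝ}
    (hu : u ∈ U)
    (hfr : LinearIndependent ℝ
      ![mfderiv 𝓘(ℝ, ℝ × ℝ) I W u (1, 0), mfderiv 𝓘(ℝ, ℝ × ℝ) I W u (0, 1), ξ (W u), η (W u)]) :
    IsLocalDiffeomorphAt 𝓘(ℝ, (ℝ × ℝ) × (ℝ × ℝ)) I ∞ Θ (u, 0) := by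
  have hdim : Module.finrank ℝ ((ℝ × ℝ) × (ℝ × ℝ)) = Module.finrank ℝ E := by
    simp [Module.finrank_prod, hE]
  exact isLocalDiffeomorphAt_of_mfderiv_injective ((hU.prod isOpen_univ))
    (⟨hu, mem_univ _⟩ : ((u, 0) : (ℝ × ℝ) × (ℝ × ℝ)) ∈ U ×ˢ univ)
    (contMDiffOn_flowTube Φ Ψ W hΘ hW) (by simp) hdim
    (injective_mfderiv_flowTube Φ Ψ W hΘ hΦ hΨ hU hW hu hfr)

end Deriv

end Tube

/-! ### Flow invariance of an immersed sheet under a tangent field -/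

section Invariance

variable {E : Type*} [NormedAddCommGroup E] [NormedSpace ℝ E] {H : Type*} [TopologicalSpace H]
  {I : ModelWithCorners ℝ E H} {X : Type*} [TopologicalSpace X] [ChartedSpace H X]
  [IsManifold I ∞ X] [T2Space X] [BoundarylessManifold I X]
  {EB : Type*} [NormedAddCommGroup EB] [NormedSpace ℝ EB] [CompleteSpace EB] {HB : Type*}
  [TopologicalSpace HB] {IB : ModelWithCorners ℝ EB HB} {B : Type*} [TopologicalSpace B]
  [ChartedSpace HB B] [IsManifold IB ∞ B] [BoundarylessManifold IB B]

set_option backward.isDefEq.respectTransparency false in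
omit [IsManifold I ∞ X] [T2Space X] [BoundarylessManifold I X] [CompleteSpace EB]
  [IsManifold IB ∞ B] [BoundarylessManifold IB B] in
/-- **Related fields have related integral curves**: if `dp (Y b) = ξ (p b)` on `N` and `γ` is
an integral curve of `Y` on `s` with values in `N`, then `p ∘ γ` is an integral curve of `ξ` on
`s` (chain rule). [cite: LeeSmoothManifolds2013, Prop. 9.6] -/
theorem IsMIntegralCurveOn.comp_of_related {p : B → X} (hp : ContMDiff IB I 1 p)
    {Y : Π b : B, TangentSpace IB b} {ξ : Π x : X, TangentSpace I x} {N : Set B}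
    (htan : ∀ b ∈ N, mfderiv IB I p b (Y b) = ξ (p b)) {γ : ℝ → B} {s : Set ℝ}
    (hγ : IsMIntegralCurveOn γ Y s) (hγN : ∀ t ∈ s, γ t ∈ N) :
    IsMIntegralCurveOn (p ∘ γ) ξ s := by
  intro t ht
  have h1 := hγ t ht
  have h2 : HasMFDerivAt IB I p (γ t) (mfderiv IB I p (γ t)) :=
    ((hp (γ t)).mdifferentiableAt one_ne_zero).hasMFDerivAt
  have h3 := h2.comp_hasMFDerivWithinAt t h1
  have hL : (mfderiv IB I p (γ t)).comp ((1 : ℝ →L[ℝ] ℝ).smulRight (Y (γ t))) =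
      (1 : ℝ →L[ℝ] ℝ).smulRight (ξ ((p ∘ γ) t)) := by
    ext
    show mfderiv IB I p (γ t) (((1 : ℝ →L[ℝ] ℝ) 1) • Y (γ t)) =
      ((1 : ℝ →L[ℝ] ℝ) 1) • ξ (p (γ t))
    rw [map_smul, htan (γ t) (hγN t ht)]
  exact h3.congr_mfderiv hL

/-- **Flow invariance of an immersed sheet under a tangent field** (the replacement of *"`M` is
totally geodesic, so the `x`-lines through `C` stay in `M`"*, Milnor 1965, PDF p. 45).  Let `Φ`
be an ambient isotopy of `X` whose tracks are integral curves of a `C^∞` vector field `ξ`, let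
`p : B → X` be `C^∞`, `Y` a `C^∞` vector field on `B`, and suppose `dp_b (Y b) = ξ (p b)` for
`b` in an open set `N ∋ b₀`.  Then there are a neighbourhood `N₁` of `b₀`, `ε > 0` and a map
`γ : B → ℝ → B` with `γ b t ∈ N` and `Φ_t (p b) = p (γ b t)` for `b ∈ N₁`, `|t| < ε`; in
particular the `ξ`-tracks of the points `p b`, `b ∈ N₁`, stay in `p(N)` for `|t| < ε`
(smooth local flow of `Y`, naturality, uniqueness of integral curves).
[cite: MilnorHCobordism1965, Completion of Proof of Lemma 6.7 (PDF p. 45)]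
[cite: LeeSmoothManifolds2013, Prop. 9.6, Thm. 9.12 (a)] -/
theorem flow_apply_eq_of_tangent (Φ : AmbientIsotopy I X) {ξ : Π x : X, TangentSpace I x}
    (hξ : ContMDiff I I.tangent ∞ fun x => (⟨x, ξ x⟩ : TangentBundle I X))
    (hΦ : ∀ x, IsMIntegralCurve (fun t => Φ.toFun t x) ξ)
    {p : B → X} (hp : ContMDiff IB I ∞ p)
    {Y : Π b : B, TangentSpace IB b}
    (hY : ContMDiff IB IB.tangent ∞ fun b => (⟨b, Y b⟩ : TangentBundle IB B))
    {N : Set B} (hN : IsOpen N) (htan : ∀ b ∈ N, mfderiv IB I p b (Y b) = ξ (p b))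
    {b₀ : B} (hb₀ : b₀ ∈ N) :
    ∃ N₁ ∈ 𝓝 b₀, ∃ ε > (0 : ℝ), ∃ γ : B → ℝ → B,
      (∀ b ∈ N₁, γ b 0 = b) ∧
      (∀ b ∈ N₁, ∀ t ∈ Ioo (-ε) ε, γ b t ∈ N ∧ Φ.toFun t (p b) = p (γ b t)) := by
  -- the smooth local flow of `Y` about `b₀`
  obtain ⟨U, hUo, hb₀U, ε, hε, γ, hγ0, hγc, hγs⟩ :=
    exists_contMDiffOn_localFlow hY (BoundarylessManifold.isInteriorPoint (x := b₀))
  -- shrink so that the local flow stays in `N`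
  have hcont : ContinuousAt (fun q : B × ℝ => γ q.1 q.2) (b₀, 0) :=
    (hγs.continuousOn.continuousWithinAt ⟨hb₀U, by simp [hε]⟩).continuousAt
      ((hUo.prod isOpen_Ioo).mem_nhds ⟨hb₀U, by simp [hε]⟩)
  have hpre : (fun q : B × ℝ => γ q.1 q.2) ⁻¹' N ∈ 𝓝 ((b₀, 0) : B × ℝ) := by
    refine hcont.preimage_mem_nhds (hN.mem_nhds ?_)
    show γ b₀ 0 ∈ N
    rw [hγ0 b₀ hb₀U]
    exact hb₀
  obtain ⟨N₁, hN₁, T, hT, hsub⟩ := mem_nhds_prod_iff.1 hpre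
  obtain ⟨δ, hδ, hδT⟩ := Metric.mem_nhds_iff.1 hT
  set ε₁ := min ε δ with hε₁
  have hε₁ : 0 < ε₁ := lt_min hε hδ
  have hIoo : Ioo (-ε₁) ε₁ ⊆ Ioo (-ε) ε := fun t ht =>
    ⟨lt_of_le_of_lt (neg_le_neg (min_le_left _ _)) ht.1, lt_of_lt_of_le ht.2 (min_le_left _ _)⟩
  have hIooT : Ioo (-ε₁) ε₁ ⊆ T := fun t ht => hδT (by
    rw [Metric.mem_ball, Real.dist_0_eq_abs, abs_lt]
    exact ⟨lt_of_le_of_lt (neg_le_neg (min_le_right _ _)) ht.1,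
      lt_of_lt_of_le ht.2 (min_le_right _ _)⟩)
  refine ⟨N₁ ∩ U, inter_mem hN₁ (hUo.mem_nhds hb₀U), ε₁, hε₁, γ, fun b hb => hγ0 b hb.2,
    fun b hb t ht => ?_⟩
  have hmemN : ∀ t' ∈ Ioo (-ε₁) ε₁, γ b t' ∈ N := fun t' ht' =>
    hsub (mk_mem_prod hb.1 (hIooT ht'))
  refine ⟨hmemN t ht, ?_⟩
  -- `p ∘ γ b` and the `ξ`-track of `p b` are integral curves of `ξ` through `p b`
  have hc1 : IsMIntegralCurveOn (p ∘ γ b) ξ (Ioo (-ε₁) ε₁) :=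
    IsMIntegralCurveOn.comp_of_related (hp.of_le (by simp)) htan ((hγc b hb.2).mono hIoo) hmemN
  have hc2 : IsMIntegralCurveOn (fun t => Φ.toFun t (p b)) ξ (Ioo (-ε₁) ε₁) :=
    (hΦ (p b)).isMIntegralCurveOn _
  have h0 : (fun t => Φ.toFun t (p b)) 0 = (p ∘ γ b) 0 := by
    show Φ.toFun 0 (p b) = p (γ b 0)
    rw [Φ.map_zero, hγ0 b hb.2]
    rfl
  have h00 : (0 : ℝ) ∈ Ioo (-ε₁) ε₁ := ⟨by linarith, hε₁⟩
  exact isMIntegralCurveOn_Ioo_eqOn_of_contMDiff_boundaryless h00 (hξ.of_le (by simp)) hc2 hc1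
    h0 ht

end Invariance

end Literature.Topology.FourManifolds
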